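import Literature.AlgebraicGeometry.Resolution.KawasakiCharts
import Literature.AlgebraicGeometry.Resolution.KawasakiLocalAnalysis
import Literature.AlgebraicGeometry.Resolution.ProjectiveSpaceRegular
import Literature.RingTheory.KrullDimension.AffineCatenary
import Literature.RingTheory.KrullDimension.LocalizationDimension
import Mathlib.RingTheory.Localization.BaseChange
import Mathlib.Algebra.Module.LocalizedModule.IsLocalization
import HarnessLib

/-!
# The stalk of a closed subscheme of `ℙⁿ_k` at a point of a standard chart, over the regular local
ring of the chart

Topic: `Literature/AlgebraicGeometry/Resolution` (chart-to-stalk dictionary of the globalization step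
of Kawasaki's Macaulayfication, Kawasaki 2000, §5, proof of Thm. 5.1, p. 2539: "let `p ∈ X` be a
closed point … `𝒪_{X,p}` is a homomorphic image of the regular local ring `𝒪_{ℙⁿ,p}`", so that the
local analysis (`KawasakiLocalAnalysis.lean`) and the global-to-local bridge
`mem_secantColonAnnihilator_of_mem_extAnn` apply to it).

For a closed immersion `ι : Z → ℙⁿ_k`, a standard chart `Z_j = ι⁻¹ D₊(x_j)` with ring of sections
`A_j = Γ(Z, Z_j)`, chart ring `B_j = (k[x]_{(x_j)})₀ ≅ k[y₁, …, yₙ]` of `ℙⁿ` (`KawasakiCharts.lean`)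
and a point `x ∈ Z_j`:

* `projChartPrime ι j x` — the prime `𝔮 ⊂ B_j` under `x` (preimage of the prime `𝔭_x ⊂ A_j` of `x`
  along the surjection `evalAway : B_j ↠ A_j`); `ChartLocal ι j x = (B_j)_𝔮`, a REGULAR local ring
  (`isRegularLocalRing_chartLocal`; `B_j` is a regular ring, `ProjectiveSpaceRegular.lean`), of
  dimension `n` when `x` is a closed point (`ringKrullDim_chartLocal`: `𝔮` is then maximal in the
  `n`-dimensional affine domain `B_j`);
* `chartLocalToStalk ι j x : (B_j)_𝔮 →+* 𝒪_{Z,x}` — the canonical SURJECTION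
  (`chartLocalToStalk_surjective`: `𝒪_{Z,x} = (A_j)_{𝔭_x}`, Mathlib
  `IsAffineOpen.isLocalization_stalk`, and `B_j ↠ A_j`);
* for an ideal `I ≤ A_j` with extension `I𝒪_{Z,x}`: the quotient `𝒪_{Z,x} ⧸ I𝒪_{Z,x}` is the BASE
  CHANGE to `(B_j)_𝔮` of the chart module `ChartQuot ι (X j) I = A_j ⧸ I` of `KawasakiCharts.lean`
  (`isBaseChange_chartQuotToStalkQuot`: localization of a quotient is the quotient of the
  localization), it is a finite module with `supportDim = ringKrullDim (𝒪_{Z,x} ⧸ I𝒪_{Z,x})`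
  (`supportDim_stalkQuot`);
* `mem_secantColonAnnihilator_stalkQuot_of_mem_chartAnn` — hence, at a CLOSED point `x`, an element
  of Kawasaki's annihilator ideal of the chart `chartAnn ι j I (n - d, max n 2]`,
  `d = dim 𝒪_{Z,x} ⧸ I𝒪_{Z,x}`, maps into Schenzel's `𝔯_{(B_j)_𝔮}(𝒪_{Z,x} ⧸ I𝒪_{Z,x})`
  (`KawasakiLocalAnalysis.mem_secantColonAnnihilator_of_mem_extAnn`).

* `ringKrullDim_stalkQuot_le` (rev 2) — local ≤ global: `dim (𝒪_{Z,x} ⧸ I𝒪_{Z,x}) ≤ dim (A_j ⧸ I)`.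

The algebra structures `(B_j)_𝔮 → 𝒪_{Z,x} → 𝒪_{Z,x} ⧸ I𝒪` are reducible definitions
(`chartLocalStalkAlgebra`, `stalkQuotAlgebra`, …) activated with `letI` in the statements, as for
`KawasakiCharts.awayMulAlgebra`; no global instances are declared.

Everything is proved; no named facts.

## References

* T. Kawasaki, *On Macaulayfication of Noetherian schemes*, Trans. AMS 352 (2000), §5, proof of
  Thm. 5.1 (p. 2539). [Kawasaki2000]
* R. Hartshorne, *Algebraic Geometry* (1977), II Prop. 2.5 (b), II Prop. 5.9, II Ex. 5.10.
  [Hartshorne1977]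
* The Stacks Project, Tags 01I9 (stalks of affine schemes), 00CS / 02C1 (localization commutes
  with quotients). [StacksProject]
-/

noncomputable section

open CategoryTheory AlgebraicGeometry TopologicalSpace HomogeneousLocalization MvPolynomial
open Literature.AlgebraicGeometry.Morphisms Literature.AlgebraicGeometry.Morphisms.ProjCech
open Literature.AlgebraicGeometry.Motives Literature.AlgebraicGeometry.Motives.ProjFrac
open IsLocalRing

universe u

attribute [local instance] MvPolynomial.gradedAlgebra
  Literature.AlgebraicGeometry.Motives.ProjBaseChange.algebraBase

namespace Literature.AlgebraicGeometry.Resolution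

variable {k : Type u} [Field k] {n : ℕ} {Z : Scheme.{u}} (ι : Z ⟶ PP k n) [IsClosedImmersion ι]
  (j : Fin (n + 1))

/-! ## The chart, its points and primes -/

/-- The standard chart `Z_j = ι⁻¹ D₊(x_j)` of a closed subscheme of `ℙⁿ` is affine (`D₊(x_j)` is
affine and a closed immersion is an affine morphism). [cite: Hartshorne1977, II Prop. 2.5 (b) and II Prop. 5.9] -/
theorem isAffineOpen_ZH_X : IsAffineOpen (ZH ι (X j)) :=
  isAffineOpen_ZH ι (Segre.X_mem k j) one_pos

variable (x : ZH ι (X j : MvPolynomial (Fin (n + 1)) k))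

/-- The prime `𝔭_x ⊂ A_j = Γ(Z, Z_j)` of the point `x ∈ Z_j`. [folklore] -/
abbrev sectionsPrime : PrimeSpectrum Γ(Z, ZH ι (X j)) := (isAffineOpen_ZH_X ι j).primeIdealOf x

/-- **The prime `𝔮 ⊂ B_j = (k[x]_{(x_j)})₀` under the point `x ∈ Z_j`**: the preimage of `𝔭_x`
along `evalAway : B_j ↠ A_j` (the point `ι x ∈ D₊(x_j) = Spec B_j`). [folklore] -/
def projChartPrime : PrimeSpectrum (Away (grading k n) (X j : MvPolynomial (Fin (n + 1)) k)) :=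
  ⟨(sectionsPrime ι j x).asIdeal.comap (evalAway ι (X j)), Ideal.comap_isPrime _ _⟩

/-- **The regular local ring `(B_j)_𝔮` of `ℙⁿ` at the point** (Kawasaki's `𝒪_{ℙⁿ,p}`). [folklore] -/
abbrev ChartLocal : Type u := Localization.AtPrime (projChartPrime ι j x).asIdeal

/-- **`(B_j)_𝔮` is a regular local ring** (`B_j ≅ k[y₁,…,yₙ]`, Hartshorne II Prop. 2.5 (b), is a
regular ring: a polynomial ring over a field). [cite: Matsumura1987, Thm. 19.5] -/
theorem isRegularLocalRing_chartLocal : IsRegularLocalRing (ChartLocal ι j x) := by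
  haveI : IsRegularRing (Away (grading k n) (X j : MvPolynomial (Fin (n + 1)) k)) :=
    isRegularRing_chart n k j
  infer_instance

/-! ## The surjection `(B_j)_𝔮 ↠ 𝒪_{Z,x}` -/

/-- `B_j → 𝒪_{Z,x}`: evaluate on the chart, then take the germ at `x`. [folklore] -/
def chartToStalk : Away (grading k n) (X j : MvPolynomial (Fin (n + 1)) k) →+* (Z.presheaf.stalk x : Type u) :=
  (algebraMap Γ(Z, ZH ι (X j)) (Z.presheaf.stalk x)).comp (evalAway ι (X j))

/-- Elements of `B_j` outside `𝔮` become units in `𝒪_{Z,x}` (the stalk is `(A_j)_{𝔭_x}`).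
[cite: Hartshorne1977, II Prop. 2.2 (a)] -/
theorem isUnit_chartToStalk (s : (projChartPrime ι j x).asIdeal.primeCompl) : IsUnit (chartToStalk ι j x s) := by
  haveI := (isAffineOpen_ZH_X ι j).isLocalization_stalk x
  have hs : evalAway ι (X j) (s : Away (grading k n) (X j)) ∈ (sectionsPrime ι j x).asIdeal.primeCompl :=
    fun h => s.2 h
  exact IsLocalization.map_units (Z.presheaf.stalk x) (⟨_, hs⟩ : (sectionsPrime ι j x).asIdeal.primeCompl)

/-- **`(B_j)_𝔮 → 𝒪_{Z,x}`**, the local homomorphism of Kawasaki's "`𝒪_{X,p}` is a homomorphic image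
of `𝒪_{ℙⁿ,p}`". [cite: Kawasaki2000, §5 p. 2539] -/
def chartLocalToStalk : ChartLocal ι j x →+* (Z.presheaf.stalk x : Type u) :=
  IsLocalization.lift (M := (projChartPrime ι j x).asIdeal.primeCompl) (S := ChartLocal ι j x)
    (isUnit_chartToStalk ι j x)

/-- `(B_j)_𝔮 → 𝒪_{Z,x}` extends `B_j → A_j → 𝒪_{Z,x}`: on `b ∈ B_j` it is the germ of the chart
value `evalAway b` (the map `A_𝔭 → 𝒪_𝔭` extends `A → Γ → 𝒪_𝔭`). [cite: Hartshorne1977, II Prop. 2.2 (a)] -/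
theorem chartLocalToStalk_algebraMap (b : Away (grading k n) (X j : MvPolynomial (Fin (n + 1)) k)) :
    chartLocalToStalk ι j x (algebraMap _ (ChartLocal ι j x) b) =
      algebraMap Γ(Z, ZH ι (X j)) (Z.presheaf.stalk x) (evalAway ι (X j) b) :=
  IsLocalization.lift_eq _ b

/-- **`(B_j)_𝔮 ↠ 𝒪_{Z,x}` is surjective** for a closed immersion `ι` (`B_j ↠ A_j`, Hartshorne II 5.9 /
5.10, and `𝒪_{Z,x} = (A_j)_{𝔭_x}`). [cite: Hartshorne1977, II Prop. 5.9] -/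
theorem chartLocalToStalk_surjective : Function.Surjective (chartLocalToStalk ι j x) := by
  haveI := (isAffineOpen_ZH_X ι j).isLocalization_stalk x
  intro o
  obtain ⟨⟨a, s⟩, rfl⟩ := IsLocalization.mk'_surjective (sectionsPrime ι j x).asIdeal.primeCompl o
  obtain ⟨b, hb⟩ := evalAway_surjective ι (Segre.X_mem k j) one_pos a
  obtain ⟨t, ht⟩ := evalAway_surjective ι (Segre.X_mem k j) one_pos (s : Γ(Z, ZH ι (X j)))
  have hts : t ∈ (projChartPrime ι j x).asIdeal.primeCompl := by
    intro h
    apply s.2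
    show (s : Γ(Z, ZH ι (X j))) ∈ (sectionsPrime ι j x).asIdeal
    rw [← ht]; exact h
  refine ⟨IsLocalization.mk' (ChartLocal ι j x) b ⟨t, hts⟩, ?_⟩
  have hu := IsLocalization.map_units (Z.presheaf.stalk x) s
  refine (hu.mul_left_inj).mp ?_
  rw [IsLocalization.mk'_spec]
  have h1 : chartLocalToStalk ι j x (IsLocalization.mk' (ChartLocal ι j x) b ⟨t, hts⟩) *
      chartLocalToStalk ι j x (algebraMap _ (ChartLocal ι j x) t) =
        chartLocalToStalk ι j x (algebraMap _ (ChartLocal ι j x) b) := by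
    rw [← map_mul, IsLocalization.mk'_spec (ChartLocal ι j x) b ⟨t, hts⟩]
  rw [chartLocalToStalk_algebraMap, chartLocalToStalk_algebraMap, hb, ht] at h1
  exact h1

/-- The `(B_j)_𝔮`-algebra structure of `𝒪_{Z,x}` (activate with `letI`; the induced structures
on the quotients `𝒪_{Z,x} ⧸ J` are then Mathlib's `Ideal.Quotient.algebra` /
`Submodule.Quotient.module'`). [folklore] -/
@[reducible] def chartLocalStalkAlgebra : Algebra (ChartLocal ι j x) (Z.presheaf.stalk x : Type u) :=
  (chartLocalToStalk ι j x).toAlgebra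

/-- The `B_j`-algebra structure of `𝒪_{Z,x}` THROUGH `(B_j)_𝔮` (activate with `letI`; by
`chartLocalToStalk_algebraMap` its structure map is `B_j → A_j → 𝒪_{Z,x}`, but it is defined as the
composite `B_j → (B_j)_𝔮 → 𝒪_{Z,x}` so that the tower holds by `rfl`). [folklore] -/
@[reducible] def awayStalkAlgebra :
    Algebra (Away (grading k n) (X j : MvPolynomial (Fin (n + 1)) k)) (Z.presheaf.stalk x : Type u) :=
  ((chartLocalToStalk ι j x).comp (algebraMap _ (ChartLocal ι j x))).toAlgebra

/-- The tower `B_j → (B_j)_𝔮 → 𝒪_{Z,x}`; needed as a `haveI` in the statements about base change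
below (Kawasaki: `𝒪_{X,p}` and its quotients as modules over `𝒪_{ℙⁿ,p}` and over the chart ring).
[cite: Kawasaki2000, §5 p. 2539 (the `𝒪_{ℙⁿ,p}`-modules `𝒪_{X,p}/(z_{i+1},…,z_d)`)] -/
theorem isScalarTower_chartLocal_stalk :
    letI := chartLocalStalkAlgebra ι j x
    letI := awayStalkAlgebra ι j x
    IsScalarTower (Away (grading k n) (X j : MvPolynomial (Fin (n + 1)) k)) (ChartLocal ι j x)
      (Z.presheaf.stalk x : Type u) :=
  letI := chartLocalStalkAlgebra ι j x
  letI := awayStalkAlgebra ι j x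
  IsScalarTower.of_algebraMap_eq' (R := Away (grading k n) (X j : MvPolynomial (Fin (n + 1)) k))
    (S := ChartLocal ι j x) (A := (Z.presheaf.stalk x : Type u)) rfl

/-- The structure map of `awayStalkAlgebra` is `B_j → A_j → 𝒪_{Z,x}` (evaluate, take the germ).
[cite: Hartshorne1977, II Prop. 2.2 (a)] -/
theorem awayStalkAlgebra_algebraMap_apply (b : Away (grading k n) (X j : MvPolynomial (Fin (n + 1)) k)) :
    letI := awayStalkAlgebra ι j x
    algebraMap _ (Z.presheaf.stalk x : Type u) b =
      algebraMap Γ(Z, ZH ι (X j)) (Z.presheaf.stalk x) (evalAway ι (X j) b) :=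
  chartLocalToStalk_algebraMap ι j x b

/-! ## Closed points: `𝔮` is maximal, `dim (B_j)_𝔮 = n` -/

/-- At a closed point `x` the prime `𝔭_x ⊂ A_j` is maximal (closed points of `Spec A` are the
maximal ideals). [cite: Hartshorne1977, II Ex. 2.9 and II Prop. 2.2] -/
private theorem sectionsPrime_isMaximal (hxc : IsClosed ({(x : Z)} : Set Z)) :
    (sectionsPrime ι j x).asIdeal.IsMaximal :=
  (isAffineOpen_ZH_X ι j).primeIdealOf_isMaximal_of_isClosed x hxc

/-- **At a closed point `x` the prime `𝔮 ⊂ B_j` is maximal** (`𝔭_x` is maximal and `B_j ↠ A_j`).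
[cite: Kawasaki2000, §5 p. 2539 ("let p ∈ X be a closed point")] -/
theorem chartPrime_isMaximal (hxc : IsClosed ({(x : Z)} : Set Z)) : (projChartPrime ι j x).asIdeal.IsMaximal := by
  haveI := sectionsPrime_isMaximal ι j x hxc
  exact Ideal.comap_isMaximal_of_surjective _ (evalAway_surjective ι (Segre.X_mem k j) one_pos)

omit [IsClosedImmersion ι] in
/-- `dim B_j = n` (`B_j ≅ k[y₁,…,yₙ]`, Hartshorne II Prop. 2.5 (b), and `dim k[y₁,…,yₙ] = n`).
[cite: Matsumura1987, Thm. 5.6] -/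
theorem ringKrullDim_away_X :
    ringKrullDim (Away (grading k n) (X j : MvPolynomial (Fin (n + 1)) k)) = n := by
  rw [ringKrullDim_eq_of_ringEquiv (ProjectiveSpace.chartAlgEquiv k j).toRingEquiv,
    MvPolynomial.ringKrullDim_of_isNoetherianRing, ringKrullDim_eq_zero_of_field]
  simp

/-- **`dim (B_j)_𝔮 = n` at a closed point** (`𝔮` is a maximal ideal of the `n`-dimensional affine
domain `B_j` over `k`: `dim B_j ⧸ 𝔮 + ht 𝔮 = dim B_j`). [cite: Matsumura1987, Thm. 5.6] -/
theorem ringKrullDim_chartLocal (hxc : IsClosed ({(x : Z)} : Set Z)) :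
    ringKrullDim (ChartLocal ι j x) = n := by
  haveI := chartPrime_isMaximal ι j x hxc
  haveI : Algebra.FiniteType k (Away (grading k n) (X j : MvPolynomial (Fin (n + 1)) k)) :=
    (inferInstance : Algebra.FiniteType k (MvPolynomial (Fin n) k)).equiv
      (ProjectiveSpace.chartAlgEquiv k j).symm
  rw [IsLocalization.AtPrime.ringKrullDim_eq_height (projChartPrime ι j x).asIdeal (ChartLocal ι j x)]
  have h2 := Literature.RingTheory.KrullDimension.ringKrullDim_quotient_add_height k
    (projChartPrime ι j x).asIdeal
  letI : Field (Away (grading k n) (X j : MvPolynomial (Fin (n + 1)) k) ⧸ (projChartPrime ι j x).asIdeal) :=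
    Ideal.Quotient.field _
  rw [ringKrullDim_eq_zero_of_field, zero_add, ringKrullDim_away_X] at h2
  exact h2

/-! ## The quotients `𝒪_{Z,x} ⧸ I𝒪_{Z,x}` as base changes of the chart modules `A_j ⧸ I` -/

variable (I : Ideal Γ(Z, ZH ι (X j : MvPolynomial (Fin (n + 1)) k)))

/-- The extension `I𝒪_{Z,x}` of an ideal `I ≤ A_j` of the chart to the stalk. [folklore] -/
abbrev stalkIdealMap : Ideal (Z.presheaf.stalk x : Type u) :=
  I.map (algebraMap Γ(Z, ZH ι (X j)) (Z.presheaf.stalk x))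

/-- The quotient `𝒪_{Z,x} ⧸ I𝒪_{Z,x}` (the stalk at `x` of the closed subscheme of the chart cut out
by `I`); its module structures over `(B_j)_𝔮` and `B_j` are the quotient structures induced by
`chartLocalStalkAlgebra` / `awayStalkAlgebra`. [folklore] -/
abbrev StalkQuot : Type u := (Z.presheaf.stalk x : Type u) ⧸ stalkIdealMap ι j x I

/-- `𝒪_{Z,x} ⧸ I𝒪` as an `A_j ⧸ I`-algebra (Mathlib's `Ideal.Quotient.algebraQuotientMapQuotient`
on the type `ChartQuot ι (X j) I = A_j ⧸ I`; activate with `letI`). [folklore] -/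
@[reducible] def chartQuotStalkQuotAlgebra : Algebra (ChartQuot ι (X j) I) (StalkQuot ι j x I) :=
  inferInstanceAs (Algebra (Γ(Z, ZH ι (X j)) ⧸ I) (StalkQuot ι j x I))

/-- The tower `B_j → A_j ⧸ I → 𝒪_{Z,x} ⧸ I𝒪`: the square `B_j → A_j → 𝒪_{Z,x}` /
`B_j → (B_j)_𝔮 → 𝒪_{Z,x}` commutes (`chartLocalToStalk_algebraMap`).
[cite: Hartshorne1977, II Prop. 2.2 (a)] -/
theorem isScalarTower_chartQuot_stalkQuot :
    letI := awayStalkAlgebra ι j x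
    letI := chartQuotStalkQuotAlgebra ι j x I
    IsScalarTower (Away (grading k n) (X j : MvPolynomial (Fin (n + 1)) k)) (ChartQuot ι (X j) I)
      (StalkQuot ι j x I) := by
  letI := awayStalkAlgebra ι j x
  letI := chartQuotStalkQuotAlgebra ι j x I
  refine IsScalarTower.of_algebraMap_eq fun b => ?_
  change Ideal.Quotient.mk _ (chartLocalToStalk ι j x (algebraMap _ (ChartLocal ι j x) b)) =
    Ideal.Quotient.mk _ (algebraMap Γ(Z, ZH ι (X j)) (Z.presheaf.stalk x) (evalAway ι (X j) b))
  rw [chartLocalToStalk_algebraMap]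

/-- The image of `B_j ∖ 𝔮` in `A_j ⧸ I` is the image of `A_j ∖ 𝔭_x` (`B_j ↠ A_j`, `𝔮 = 𝔭_x ∩ B_j`).
[folklore] -/
private theorem algebraMapSubmonoid_chartQuot_eq :
    Algebra.algebraMapSubmonoid (ChartQuot ι (X j) I) (projChartPrime ι j x).asIdeal.primeCompl =
      Algebra.algebraMapSubmonoid (Γ(Z, ZH ι (X j)) ⧸ I) (sectionsPrime ι j x).asIdeal.primeCompl := by
  ext y
  simp only [Algebra.algebraMapSubmonoid, Submonoid.mem_map]
  constructor
  · rintro ⟨s, hs, rfl⟩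
    exact ⟨evalAway ι (X j) s, fun h => hs h, rfl⟩
  · rintro ⟨a, ha, rfl⟩
    obtain ⟨s, rfl⟩ := evalAway_surjective ι (Segre.X_mem k j) one_pos a
    exact ⟨s, fun h => ha h, rfl⟩

/-- **Localization commutes with quotients**: `𝒪_{Z,x} ⧸ I𝒪` is the localization of `A_j ⧸ I` at
(the image of) `B_j ∖ 𝔮` (`𝒪_{Z,x} = (A_j)_{𝔭_x}` and `S⁻¹(M/N) = S⁻¹M/S⁻¹N`).
[cite: AtiyahMacdonald1969, Cor. 3.4 (iii)] -/
theorem isLocalization_stalkQuot :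
    letI := chartQuotStalkQuotAlgebra ι j x I
    IsLocalization (Algebra.algebraMapSubmonoid (ChartQuot ι (X j) I)
      (projChartPrime ι j x).asIdeal.primeCompl) (StalkQuot ι j x I) := by
  letI := chartQuotStalkQuotAlgebra ι j x I
  haveI := (isAffineOpen_ZH_X ι j).isLocalization_stalk x
  rw [algebraMapSubmonoid_chartQuot_eq]
  exact inferInstanceAs (IsLocalization
    (Algebra.algebraMapSubmonoid (Γ(Z, ZH ι (X j)) ⧸ I) (sectionsPrime ι j x).asIdeal.primeCompl)
    ((Z.presheaf.stalk x : Type u) ⧸ I.map (algebraMap Γ(Z, ZH ι (X j)) (Z.presheaf.stalk x))))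

/-- **The comparison map `A_j ⧸ I → 𝒪_{Z,x} ⧸ I𝒪`** (`M/N → S⁻¹M/S⁻¹N`), `B_j`-linear.
[cite: AtiyahMacdonald1969, Cor. 3.4 (iii)] -/
def chartQuotToStalkQuot :
    letI := awayStalkAlgebra ι j x
    ChartQuot ι (X j) I →ₗ[Away (grading k n) (X j : MvPolynomial (Fin (n + 1)) k)] StalkQuot ι j x I :=
  letI := awayStalkAlgebra ι j x
  letI := chartQuotStalkQuotAlgebra ι j x I
  haveI := isScalarTower_chartQuot_stalkQuot ι j x I
  (IsScalarTower.toAlgHom (Away (grading k n) (X j : MvPolynomial (Fin (n + 1)) k))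
    (ChartQuot ι (X j) I) (StalkQuot ι j x I)).toLinearMap

/-- `chartQuotToStalkQuot` on classes: `ā ↦ class of the germ of a` (unfolding).
[cite: AtiyahMacdonald1969, Cor. 3.4 (iii)] -/
theorem chartQuotToStalkQuot_mk (a : Γ(Z, ZH ι (X j))) :
    chartQuotToStalkQuot ι j x I (Ideal.Quotient.mk I a) =
      Ideal.Quotient.mk _ (algebraMap Γ(Z, ZH ι (X j)) (Z.presheaf.stalk x) a) := rfl

/-- **`A_j ⧸ I → 𝒪_{Z,x} ⧸ I𝒪` is the localization of `B_j`-modules at `𝔮`.**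
[cite: AtiyahMacdonald1969, Cor. 3.4 (iii)] -/
theorem isLocalizedModule_chartQuotToStalkQuot :
    letI := awayStalkAlgebra ι j x
    IsLocalizedModule (projChartPrime ι j x).asIdeal.primeCompl (chartQuotToStalkQuot ι j x I) := by
  letI := awayStalkAlgebra ι j x
  letI := chartQuotStalkQuotAlgebra ι j x I
  haveI := isScalarTower_chartQuot_stalkQuot ι j x I
  haveI := isLocalization_stalkQuot ι j x I
  exact isLocalizedModule_iff_isLocalization.mpr ‹_›

/-- **`𝒪_{Z,x} ⧸ I𝒪_{Z,x}` is the base change of the chart module `A_j ⧸ I` to `(B_j)_𝔮`**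
(a localization of modules is the base change to the localized ring, `S⁻¹A ⊗_A M ≅ S⁻¹M`).
[cite: AtiyahMacdonald1969, Prop. 3.5 with Cor. 3.4 (iii)] -/
theorem isBaseChange_chartQuotToStalkQuot :
    letI := chartLocalStalkAlgebra ι j x
    letI := awayStalkAlgebra ι j x
    haveI := isScalarTower_chartLocal_stalk ι j x
    IsBaseChange (ChartLocal ι j x) (chartQuotToStalkQuot ι j x I) := by
  letI := chartLocalStalkAlgebra ι j x
  letI := awayStalkAlgebra ι j x
  haveI := isScalarTower_chartLocal_stalk ι j x
  haveI := isLocalizedModule_chartQuotToStalkQuot ι j x I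
  exact IsLocalizedModule.isBaseChange (projChartPrime ι j x).asIdeal.primeCompl (ChartLocal ι j x) _

/-- `(B_j)_𝔮 ↠ 𝒪_{Z,x} ⧸ I𝒪` is surjective.
[cite: Kawasaki2000, §5 p. 2539 ("a homomorphic image of the regular local ring")] -/
theorem algebraMap_stalkQuot_surjective :
    letI := chartLocalStalkAlgebra ι j x
    Function.Surjective (algebraMap (ChartLocal ι j x) (StalkQuot ι j x I)) :=
  Ideal.Quotient.mk_surjective.comp (chartLocalToStalk_surjective ι j x)

/-- `𝒪_{Z,x} ⧸ I𝒪` is a finite (indeed cyclic) `(B_j)_𝔮`-module (`(B_j)_𝔮 ↠ 𝒪_{Z,x}`).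
[cite: Kawasaki2000, §5 p. 2539 ("a homomorphic image of the regular local ring")] -/
theorem finite_stalkQuot :
    letI := chartLocalStalkAlgebra ι j x
    Module.Finite (ChartLocal ι j x) (StalkQuot ι j x I) := by
  letI := chartLocalStalkAlgebra ι j x
  exact Module.Finite.of_surjective (Algebra.linearMap (ChartLocal ι j x) (StalkQuot ι j x I))
    (algebraMap_stalkQuot_surjective ι j x I)

/-- **`dim Supp_{(B_j)_𝔮} (𝒪_{Z,x} ⧸ I𝒪) = dim (𝒪_{Z,x} ⧸ I𝒪)`** (the support of the cyclic module
`S/𝔞` is `V(𝔞)`, of dimension `dim S/𝔞`). [cite: Matsumura1987, §4 (Supp M = V(Ann M) for M finite)] -/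
theorem supportDim_stalkQuot :
    letI := chartLocalStalkAlgebra ι j x
    Module.supportDim (ChartLocal ι j x) (StalkQuot ι j x I) = ringKrullDim (StalkQuot ι j x I) := by
  letI := chartLocalStalkAlgebra ι j x
  rw [supportDim_restrictScalars_of_surjective (S := ChartLocal ι j x) (R := StalkQuot ι j x I)
    (M := StalkQuot ι j x I) (algebraMap_stalkQuot_surjective ι j x I),
    Module.supportDim_self_eq_ringKrullDim]

/-! ## Comparison with the quotients `𝒪 ⧸ (b)•𝒪` of `KawasakiLocalAnalysis` -/

variable (bs : List (Away (grading k n) (X j : MvPolynomial (Fin (n + 1)) k)))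

/-- For chart elements `b₁,…,b_m ∈ B_j` with chart values `aᵢ = evalAway bᵢ ∈ A_j`: the
`(B_j)_𝔮`-submodule `(b₁,…,b_m)•𝒪_{Z,x}` of `KawasakiLocalAnalysis` is the extended ideal
`(a₁,…,a_m)𝒪_{Z,x}`. [cite: Kawasaki2000, §5 p. 2539 (the modules `𝒪_{X,p}/(z_{i+1},…,z_d)`)] -/
theorem ofList_smul_top_eq_restrictScalars_stalkIdealMap :
    letI := chartLocalStalkAlgebra ι j x
    (Ideal.ofList (bs.map (algebraMap _ (ChartLocal ι j x))) • ⊤ :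
        Submodule (ChartLocal ι j x) (Z.presheaf.stalk x : Type u)) =
      (Submodule.restrictScalars (ChartLocal ι j x)
        (stalkIdealMap ι j x (Ideal.ofList (bs.map (evalAway ι (X j))))) :
        Submodule (ChartLocal ι j x) (Z.presheaf.stalk x : Type u)) := by
  letI := chartLocalStalkAlgebra ι j x
  rw [← restrictScalars_ofList_map_smul_top (R := (Z.presheaf.stalk x : Type u))
    (chartLocalToStalk_surjective ι j x), ofList_smul_top_eq]
  congr 1
  rw [stalkIdealMap, Ideal.map_ofList, List.map_map, List.map_map]
  congr 2
  funext b
  exact chartLocalToStalk_algebraMap ι j x b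

/-- **`𝒪_{Z,x} ⧸ (b)•𝒪_{Z,x} ≅ 𝒪_{Z,x} ⧸ (a)𝒪_{Z,x}`** as `(B_j)_𝔮`-modules (`aᵢ = evalAway bᵢ`): the
quotient of `KawasakiLocalAnalysis` (by the submodule generated by the chart elements) is the stalk
quotient `StalkQuot` by the extended ideal of the chart values. [cite: Kawasaki2000, §5 p. 2539] -/
def quotSMulTopEquivStalkQuot :
    letI := chartLocalStalkAlgebra ι j x
    ((Z.presheaf.stalk x : Type u) ⧸ (Ideal.ofList (bs.map (algebraMap _ (ChartLocal ι j x))) • ⊤ :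
        Submodule (ChartLocal ι j x) (Z.presheaf.stalk x : Type u))) ≃ₗ[ChartLocal ι j x]
      StalkQuot ι j x (Ideal.ofList (bs.map (evalAway ι (X j)))) :=
  letI := chartLocalStalkAlgebra ι j x
  (Submodule.quotEquivOfEq _ _ (ofList_smul_top_eq_restrictScalars_stalkIdealMap ι j x bs)).trans
    (Submodule.Quotient.restrictScalarsEquiv (ChartLocal ι j x) _)

/-! ## The bridge at a closed point -/

/-- **From Kawasaki's annihilator ideal of the chart to `𝔯` of the local ring.** Let `x ∈ Z_j` be a
CLOSED point, `I ≤ A_j` with `x ∈ V(I)` (i.e. `I𝒪_{Z,x} ≠ 𝒪_{Z,x}`) and `d = dim (𝒪_{Z,x} ⧸ I𝒪_{Z,x})`.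
Every `b ∈ chartAnn ι j I (n - d, max n 2]` (the `Ext`-annihilator ideal
`∏_q Ann Ext^q_{B_j}(A_j ⧸ I, B_j)` of `KawasakiCharts.lean`) maps into Schenzel's ideal
`𝔯_{(B_j)_𝔮}(𝒪_{Z,x} ⧸ I𝒪_{Z,x})`: `(B_j)_𝔮` is regular local of dimension `n`, the module is the
base change of `A_j ⧸ I`, and `mem_secantColonAnnihilator_of_mem_extAnn` applies (Kawasaki 2000,
p. 2539: "`z_i ∈ 𝔞(𝒪_{X,p} / (z_{i+1}, …, z_d))`").
[cite: Kawasaki2000, §5 p. 2539, with La. 2.5 and La. 5.3] -/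
theorem mem_secantColonAnnihilator_stalkQuot_of_mem_chartAnn (hxc : IsClosed ({(x : Z)} : Set Z))
    (hI : stalkIdealMap ι j x I ≠ ⊤) {d : ℕ} (hd : ringKrullDim (StalkQuot ι j x I) = d)
    {b : Away (grading k n) (X j : MvPolynomial (Fin (n + 1)) k)}
    (hb : b ∈ chartAnn ι j I (Finset.Ioc (n - d) (max n 2))) :
    letI := chartLocalStalkAlgebra ι j x
    algebraMap _ (ChartLocal ι j x) b ∈ secantColonAnnihilator (ChartLocal ι j x) (StalkQuot ι j x I) := by
  letI := chartLocalStalkAlgebra ι j x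
  letI := awayStalkAlgebra ι j x
  haveI := isScalarTower_chartLocal_stalk ι j x
  haveI := isRegularLocalRing_chartLocal ι j x
  haveI := finite_stalkQuot ι j x I
  haveI : Nontrivial (StalkQuot ι j x I) := Ideal.Quotient.nontrivial_iff.mpr hI
  exact mem_secantColonAnnihilator_of_mem_extAnn (projChartPrime ι j x).asIdeal.primeCompl
    (chartQuotToStalkQuot ι j x I) (isBaseChange_chartQuotToStalkQuot ι j x I)
    (ringKrullDim_chartLocal ι j x hxc) (by rw [supportDim_stalkQuot, hd]) hb

/-- **The bridge in the currency of `KawasakiLocalAnalysis`**: the same membership for the quotient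
`𝒪_{Z,x} ⧸ (b₁,…,b_m)•𝒪_{Z,x}` by chart elements `bᵢ ∈ B_j` (with `I = (evalAway b₁, …, evalAway b_m)`),
transported along `quotSMulTopEquivStalkQuot`. [cite: Kawasaki2000, §5 p. 2539, with La. 2.5 and La. 5.3] -/
theorem mem_secantColonAnnihilator_quotSMulTop_of_mem_chartAnn (hxc : IsClosed ({(x : Z)} : Set Z))
    (hI : stalkIdealMap ι j x (Ideal.ofList (bs.map (evalAway ι (X j)))) ≠ ⊤) {d : ℕ}
    (hd : ringKrullDim (StalkQuot ι j x (Ideal.ofList (bs.map (evalAway ι (X j))))) = d)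
    {b : Away (grading k n) (X j : MvPolynomial (Fin (n + 1)) k)}
    (hb : b ∈ chartAnn ι j (Ideal.ofList (bs.map (evalAway ι (X j)))) (Finset.Ioc (n - d) (max n 2))) :
    letI := chartLocalStalkAlgebra ι j x
    algebraMap _ (ChartLocal ι j x) b ∈ secantColonAnnihilator (ChartLocal ι j x)
      ((Z.presheaf.stalk x : Type u) ⧸ (Ideal.ofList (bs.map (algebraMap _ (ChartLocal ι j x))) • ⊤ :
        Submodule (ChartLocal ι j x) (Z.presheaf.stalk x : Type u))) := by
  letI := chartLocalStalkAlgebra ι j x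
  rw [secantColonAnnihilator_congr (quotSMulTopEquivStalkQuot ι j x bs)]
  exact mem_secantColonAnnihilator_stalkQuot_of_mem_chartAnn ι j x _ hxc hI hd hb

/-! ## Local ≤ global: `dim (𝒪_{Z,x} ⧸ I𝒪_{Z,x}) ≤ dim (A_j ⧸ I)` (rev 2) -/

/-- **Local ≤ global: `dim (𝒪_{Z,x} ⧸ I𝒪_{Z,x}) ≤ dim (A_j ⧸ I)`** — the stalk quotient is a
localization of the chart quotient `ChartQuot ι (X j) I = A_j ⧸ I` (`isLocalization_stalkQuot`,
and `dim S⁻¹R ≤ dim R`, `Literature.RingTheory.KrullDimension.ringKrullDim_le_of_isLocalization`).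
This is the half of the dimension bookkeeping of Kawasaki's local analysis that lives on the stalk
side ("`dim 𝒪_{X,p}/(z_{i+1},…,z_d) ≤ dim V(z_{i+1},…,z_d)`"); the chart-vs-projective half is the
affine dimension formula. [cite: Kawasaki2000, §5 p. 2539 (items 1–2)] -/
theorem ringKrullDim_stalkQuot_le :
    ringKrullDim (StalkQuot ι j x I) ≤ ringKrullDim (ChartQuot ι (X j) I) := by
  letI := chartQuotStalkQuotAlgebra ι j x I
  haveI := isLocalization_stalkQuot ι j x I
  exact Literature.RingTheory.KrullDimension.ringKrullDim_le_of_isLocalization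
    (Algebra.algebraMapSubmonoid (ChartQuot ι (X j) I) (projChartPrime ι j x).asIdeal.primeCompl)
    (StalkQuot ι j x I)

/-- **`dim (𝒪_{Z,x} ⧸ I𝒪_{Z,x}) ≤ dim (A_j ⧸ I)`, quotient-ring form** (`ChartQuot ι (X j) I` is
`Γ(Z, Z_j) ⧸ I` by definition). [cite: Kawasaki2000, §5 p. 2539 (items 1–2)] -/
theorem ringKrullDim_stalkQuot_le_quotient :
    ringKrullDim (StalkQuot ι j x I) ≤ ringKrullDim (Γ(Z, ZH ι (X j)) ⧸ I) :=
  ringKrullDim_stalkQuot_le ι j x I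

/-- The extended ideal of the chart values of chart elements `b₁,…,b_m ∈ B_j` is the ideal of the
stalk generated by their images under `B_j → 𝒪_{Z,x}` — the shape `Ideal.ofList (… .map (algebraMap
B 𝒪))` in which `KawasakiPointwise.lean` indexes its levels. [cite: Kawasaki2000, §5 p. 2539] -/
theorem stalkIdealMap_ofList_eq :
    letI := awayStalkAlgebra ι j x
    stalkIdealMap ι j x (Ideal.ofList (bs.map (evalAway ι (X j)))) =
      Ideal.ofList (bs.map (algebraMap _ (Z.presheaf.stalk x : Type u))) := by
  letI := awayStalkAlgebra ι j x
  rw [stalkIdealMap, Ideal.map_ofList, List.map_map]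
  congr 2
  funext b
  exact (awayStalkAlgebra_algebraMap_apply ι j x b).symm

end Literature.AlgebraicGeometry.Resolution

end
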